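import Literature.AnabelianGeometry.EtaleTheta.Discharge.Sec4NonVacuity
import Literature.AnabelianGeometry.EtaleTheta.Discharge.Sec5OfConnectedTemperoid
import Literature.AnabelianGeometry.EtaleTheta.Discharge.Sec5Prop55GaloisLeafConnectedBase
import Literature.AlgebraicGeometry.Frobenioids.QuasiTemperoidConnectedPart

/-!
# [EtTh] Def. 3.6 (ii) / Def. 4.1 over the GENUINE connected base `B^temp(Π^tp_X)⁰`: the typed tempered-Frobenioid interface and
# the §4 bi-Kummer setting are INHABITED there, for EVERY `Π^tp_X ↠ G_K` (consistency witness; Def. 3.6 p.302, Def. 4.1 pp.312–313 /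
# PDF pp.76, 86–87)

S. Mochizuki, *The étale theta function and its Frobenioid-theoretic manifestations*, Publ. RIMS **45** (2009), Def. 3.6 (ii)
p.302 (PDF p.76) «a connected, totally epimorphic category `D`, equipped with a functor `D → D₀`», Def. 4.1 pp.312–313 (PDF pp.86–87)
[cite: MochizukiEtTh2009, Def 3.6 p.302 (PDF p.76); Def 4.1 p.312–313 (PDF pp.86–87)]; S. Mochizuki, *The geometry of Frobenioids II*,
Kyushu J. Math. **62** (2008), Ex. 1.3 (iii) pp.11–12 («`B^temp(Π)⁰` … connected, totally epimorphic») [cite: MochizukiFrdII2008, Ex 1.3 (iii) pp.11-12].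
Cell abc-iut, layer L2, seat abc-iut-w4-d099 (gen 4).  CLASS (b) MODEL / NON-VACUITY construction under the L2 DEFS-FREEZE (rule (B)(3)(b):
the only definitions are witness DATA — a vocabulary record, one tempered-Frobenioid inhabitant, one §4 setting; no `Prop`-valued definition,
no named fact, nothing landed is edited).

WHY.  This seat's finding F-w4d099-1 (`TemperedFrobenioid.isEmpty_of_bTemp`, `Discharge/Sec3TemperedFrobenioidBTempVacuity.lean`, p425482)
showed that over the FULL temperoid `B^temp(Π)` the typed interface `TemperedFrobenioid T (BTemp Π) VD` is EMPTY (Def. 3.6 (ii) demands a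
connected, totally epimorphic `D`), so that every declaration parametrised by it was vacuous; the §4–§5 programme was accordingly RE-BASED
onto print's `B^temp(Π^tp_X)⁰ = ConnectedPart (BTemp X.Pi)` (abc-iut-L2-t4 `BiKummerSetting.mkOfConnectedTemperoid` /
`ThetaFrobenioid.ofConnectedTemperoidData`, ROW W3-L2-01; this seat's rows R43 / R157; abc-iut-w4-d042's (Q,P) laws; abc-iut-w5-d013's
Thm 4.4 rows), whose files carry the honest line «the parameter class `TemperedFrobenioid T₀ (ConnectedPart (BTemp X.Pi)) VD` is NOT shown
inhabited here».  THIS FILE shows it IS inhabited — for EVERY topological group `Π^tp_X` of the [SemiAnbd] interface, at universe `0`: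
* `Toy.catVocabConnectedPart X` — the all-`True` [FrdI] category-vocabulary record over `B^temp(Π^tp_X)⁰` (as `Toy.catVocab` over `∗`);
* **`Toy.temperedFrobenioidQConnectedPart X : TemperedFrobenioid Toy.realifiedQ (ConnectedPart (BTemp X.Pi)) _`** — abc-iut-w5-d063 /
  this cell's PERFECT toy data `Toy.realifiedQ` (`Φ₀ = Φ^{ℝ-log} = Φ = ℚ_{≥0}`, `B₀ = B₀^Λ = ℤ`, monoid type `ℤ`) pulled back along the
  CONSTANT functor `B^temp(Π^tp_X)⁰ → ∗`; the two Def. 3.6 (ii) clauses on `D` are the tree's theorems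
  `QuasiTemperoid.BTempConnected.connectedPart_isConnected` / `connectedPart_isTotallyEpimorphic` ([FrdII] Ex. 1.3 (iii), abc-iut-L1/L3),
  the pointwise clauses ((a) `Φ^{bs-fld}` monoprime — REAL, `ℚ`-monoprime; (b) `F → (Φ^{bs-fld})^gp` nonzero — REAL) are those of
  `Toy.temperedFrobenioidQ`; `monoidType = ℤ` and `Φ` PERFECT (`…_isPerfect`);
* hence `Toy.nonempty_temperedFrobenioid_connectedPart` — CONTRAST with `TemperedFrobenioid.isEmpty_of_bTemp` over the raw temperoid;
* **`Toy.biKummerSettingConnectedPart X M NH`** — the §4 setting of Def. 4.1 over the GENUINE base `B^temp(Π^tp_X)⁰` with its GENUINE Galois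
  objects ([SemiAnbd] Def. 3.1 (iv)) and Galois surjections `galoisSurjOf` (Rmk. 3.1.3), via abc-iut-L2-t4's `BiKummerSetting.mkOfConnectedTemperoid`
  with `A_⊙ := (Π^tp_X/M, 0)` (`TemperedFrobenioid.connQuotZeroObj`: Frobenius-trivial with Galois base — abc-iut-L2-t4's theorems) for ANY
  open normal `M ≤ Π^tp_X`; **`Toy.nonempty_biKummerSetting_connectedPart`**; and, as a sample of what this un-vacuates, the law (L1)
  `galoisHomTorsor_biKummerSettingConnectedPart` (this seat's `BiKummerSetting.galoisHomTorsor_of_connectedPart`, p425830, AT the witness).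
So the W3-L2-01 / R43 / R157 / O1 / Thm 4.4-at-`B^temp(Π)⁰` theorems are statements about a NONEMPTY parameter class: only the
divisor / rational-function monoids of the witness are toy; the base category, its Galois objects and the outer Galois surjections are the
genuine ones of `Π^tp_X`.
HONEST LIMITS: a consistency certificate for the TYPED stack `DivisorMonoids → RealifiedDivisorMonoids → TemperedFrobenioid → BiKummerSetting`
at the genuine base; it is NOT the tempered Frobenioid of a curve (abc-iut-L2-t10's divisor data at the junction supply that); the free
relation slot `NH` is a parameter; inhabited ≠ faithful; nothing here bears on, or takes a side on, [IUTchIII] Cor. 3.12.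
-/

noncomputable section

namespace Literature.AnabelianGeometry.EtaleTheta

open CategoryTheory Opposite Literature.AlgebraicGeometry.Frobenioids Literature.AnabelianGeometry.SemiGraphs
  Literature.AlgebraicGeometry.Frobenioids.QuasiTemperoid.BTempConnected
open scoped NNRat

namespace Toy

variable {K : Type} [Field K] (X : SemiGraphs.TemperedArithmeticGroup.{0} K)

/-- The all-`True` [FrdI] category vocabulary over `B^temp(Π^tp_X)⁰` (as `Toy.catVocab` over the one-object base; the [FrdI]
Def. 1.1 / 4.5 predicates are free fields of `FrdICatStub`).  [cite: MochizukiEtTh2009, Def 3.6 p.302 (PDF p.76)] -/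
def catVocabConnectedPart : FrdICatStub.{1, 0, 0} (ConnectedPart (BTemp X.Pi)) where
  IsDivisorialOn _ := True
  IsRational _ := True
  IsStrictlyRational _ := True

/-- **Def. 3.6 (ii) over the GENUINE connected base**: the perfect toy data `Toy.realifiedQ` pulled back along the constant functor
`B^temp(Π^tp_X)⁰ → ∗` is a `TemperedFrobenioid` over `D := ConnectedPart (BTemp X.Pi)` — `D` is connected and totally epimorphic by
[FrdII] Ex. 1.3 (iii) (`connectedPart_isConnected`, `connectedPart_isTotallyEpimorphic`), and the pointwise clauses (group-saturated,
`Φ^{bs-fld} = ℚ_{≥0}` monoprime, `F → (Φ^{bs-fld})^gp` nonzero) are those of `Toy.temperedFrobenioidQ`.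
[cite: MochizukiEtTh2009, Def 3.6 p.302 (PDF p.76)] -/
def temperedFrobenioidQConnectedPart :
    TemperedFrobenioid realifiedQ (ConnectedPart (BTemp X.Pi)) (catVocabConnectedPart X) where
  isConnected := connectedPart_isConnected
  isTotallyEpimorphic := connectedPart_isTotallyEpimorphic
  base := (Functor.const _).obj ⟨PUnit.unit⟩
  Φ := ⟨fun _ => ⊤, fun _ _ _ => trivial⟩
  isGroupSaturated A := (isGroupSaturated_iff' _).2 fun _ _ _ _ _ _ => trivial
  isPerfFactorial _ := trivial
  isDivisorialOn := trivial
  isMonoprime_bsFld A := isMonoprime_of_eq_top_nnrat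
    (eq_top_iff.2 fun x _ => Submonoid.mem_inf.2 ⟨Submonoid.mem_top x,
      (Subgroup.mem_top (Algebra.GrothendieckGroup.of x) :
        Algebra.GrothendieckGroup.of x ∈
          (⊤ : Subgroup (Algebra.GrothendieckGroup (Multiplicative ℚ≥0))))⟩)
  exists_FΛ_div_ne A := ⟨(Multiplicative.ofAdd (1 : ℤ) : Multiplicative ℤ), trivial,
    (Multiplicative.ofAdd (1 : ℚ≥0) : Multiplicative ℚ≥0), trivial, (1 : Multiplicative ℚ≥0), trivial,
    fun h => one_ne_zero (Multiplicative.ofAdd.injective h),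
    divHomQ_ofAdd_one.trans (by
      change Algebra.GrothendieckGroup.of (M := Multiplicative ℚ≥0) (Multiplicative.ofAdd 1) =
        Algebra.GrothendieckGroup.of (M := Multiplicative ℚ≥0) (Multiplicative.ofAdd 1) /
          Algebra.GrothendieckGroup.of (M := Multiplicative ℚ≥0) 1
      rw [(Algebra.GrothendieckGroup.of (M := Multiplicative ℚ≥0)).map_one, div_one])⟩

/-- "whose monoid type is `ℤ`" (Def. 4.1) holds for the witness. [cite: MochizukiEtTh2009, Def 4.1 p.312 (PDF p.86)] -/
theorem temperedFrobenioidQConnectedPart_monoidType : (temperedFrobenioidQConnectedPart X).monoidType = MonoidType.Z := rfl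

/-- "whose divisor monoid `Φ` is perfect" (Def. 4.1) holds for the witness: `Φ(A) = ℚ_{≥0}`.
[cite: MochizukiEtTh2009, Def 4.1 p.312 (PDF p.86)] -/
theorem temperedFrobenioidQConnectedPart_isPerfect (A : (ConnectedPart (BTemp X.Pi))ᵒᵖ) :
    IsPerfect ((temperedFrobenioidQConnectedPart X).Φ.carrier A) :=
  isPerfect_of_mulEquiv_nnrat (N := ↥(⊤ : Submonoid (Multiplicative ℚ≥0))) Submonoid.topEquiv

/-- **The typed tempered-Frobenioid interface over `B^temp(Π^tp_X)⁰` is INHABITED, with monoid type `ℤ` and perfect `Φ`** — for every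
`Π^tp_X`; contrast `TemperedFrobenioid.isEmpty_of_bTemp` (the same interface over the raw temperoid `B^temp(Π)` is empty).
[cite: MochizukiEtTh2009, Def 3.6 p.302 (PDF p.76); Def 4.1 p.312 (PDF p.86)] -/
theorem nonempty_temperedFrobenioid_connectedPart :
    ∃ C : TemperedFrobenioid realifiedQ (ConnectedPart (BTemp X.Pi)) (catVocabConnectedPart X),
      C.monoidType = MonoidType.Z ∧ ∀ A, IsPerfect (C.Φ.carrier A) :=
  ⟨temperedFrobenioidQConnectedPart X, temperedFrobenioidQConnectedPart_monoidType X,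
    temperedFrobenioidQConnectedPart_isPerfect X⟩

/-- **Def. 4.1 over the GENUINE base `B^temp(Π^tp_X)⁰`**: the §4 bi-Kummer setting (abc-iut-L2-t3's `BiKummerSetting`) built by
abc-iut-L2-t4's `mkOfConnectedTemperoid` on the witness, with the GENUINE Galois objects of [SemiAnbd] Def. 3.1 (iv) and Galois surjections
of Rmk. 3.1.3, and `A_⊙ := (Π^tp_X/M, 0)` — Frobenius-trivial ([FrdI] Thm. 5.2 (i), `isFrobeniusTrivial_connQuotZeroObj`) with Galois base
(`isGaloisObj_connQuotZeroObj_base`) — for any open normal `M ≤ Π^tp_X` and any `(N,H)`-saturation relation `NH`.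
[cite: MochizukiEtTh2009, Def 4.1 p.312–313 (PDF pp.86–87)] -/
def biKummerSettingConnectedPart (M : OpenNormalSubgroup X.Pi)
    (NH : Subgroup (Field.absoluteGaloisGroup K) → (temperedFrobenioidQConnectedPart X).category → ℕ+ → Prop) :
    BiKummerSetting X realifiedQ (ConnectedPart (BTemp X.Pi)) (catVocabConnectedPart X) :=
  BiKummerSetting.mkOfConnectedTemperoid X (temperedFrobenioidQConnectedPart X) (temperedFrobenioidQConnectedPart_monoidType X)
    (temperedFrobenioidQConnectedPart_isPerfect X) NH ((temperedFrobenioidQConnectedPart X).connQuotZeroObj M)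
    (TemperedFrobenioid.isFrobeniusTrivial_connQuotZeroObj _ M) (TemperedFrobenioid.isGaloisObj_connQuotZeroObj_base _ M)

/-- The setting's tempered Frobenioid is the witness (definitionally). [cite: MochizukiEtTh2009, Def 4.1 p.312 (PDF p.86)] -/
theorem biKummerSettingConnectedPart_tf (M : OpenNormalSubgroup X.Pi)
    (NH : Subgroup (Field.absoluteGaloisGroup K) → (temperedFrobenioidQConnectedPart X).category → ℕ+ → Prop) :
    (biKummerSettingConnectedPart X M NH).tf = temperedFrobenioidQConnectedPart X := rfl

/-- **The §4 setting over the GENUINE base `B^temp(Π^tp_X)⁰` is INHABITED, for every `Π^tp_X ↠ G_K`** (take `M := Π^tp_X` itself and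
the trivial saturation relation).  [cite: MochizukiEtTh2009, Def 4.1 p.312–313 (PDF pp.86–87)] -/
theorem nonempty_biKummerSetting_connectedPart :
    Nonempty (BiKummerSetting X realifiedQ (ConnectedPart (BTemp X.Pi)) (catVocabConnectedPart X)) :=
  ⟨biKummerSettingConnectedPart X { (⊤ : OpenSubgroup X.Pi) with isNormal' := ⟨fun _ _ _ => OpenSubgroup.mem_top _⟩ }
    fun _ _ _ => True⟩

/-- **What this un-vacuates (sample): the law (L1) AT THE WITNESS** — every Galois object of the setting is an `Aut`-torsor over every
target of `B^temp(Π^tp_X)⁰` (this seat's `BiKummerSetting.galoisHomTorsor_of_connectedPart`, [SemiAnbd] Rmk. 3.1.3), now an assertion about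
an inhabited setting, its `IsGaloisObj` being literally [SemiAnbd] Def. 3.1 (iv) on the underlying `Π^tp_X`-set.
[cite: MochizukiSemiAnbd2006, Rmk 3.1.3 p.34] -/
theorem galoisHomTorsor_biKummerSettingConnectedPart (M : OpenNormalSubgroup X.Pi)
    (NH : Subgroup (Field.absoluteGaloisGroup K) → (temperedFrobenioidQConnectedPart X).category → ℕ+ → Prop) :
    ∀ ⦃A : ConnectedPart (BTemp X.Pi)⦄, (biKummerSettingConnectedPart X M NH).IsGaloisObj A →
      ∀ ⦃T : ConnectedPart (BTemp X.Pi)⦄ (b b' : A ⟶ T), ∃ g : Aut A, b' = g.hom ≫ b :=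
  BiKummerSetting.galoisHomTorsor_of_connectedPart _ fun _ hA => hA

end Toy

end Literature.AnabelianGeometry.EtaleTheta

end
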